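import Summits.AtomisticToContinuum.Crystallization.Theorems.FreeSplittingCertificatesStrictSplittingRuleP1PayTailSum

/-!
# `StrictSplittingRule` (stmt-AtomisticToContinuum-12560): THE (PAY) TAIL LEMMA — the far table's column sum over the sites OUTSIDE the `44a` box is bounded IN THE KERNEL; hypothesis (PAY) of the endpoint becomes FINITE — all five hypotheses are now finite statements (P1 interpolant object, part 92)

Route `FreeSplittingCertificates`, crux r3 `StrictSplittingRule` (H12⋆ = `stub_coreJointCoercive`), unit b2b-freesplit-B gen 39.
VALUE = a kernel theorem replacing part of an external certificate.  Hypothesis (PAY) of `coreJointCoercive_cell_of_certificates₁₀`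
(part 90) asks, per representative `p` and offset `s`, `(193/125)(2/5)a⁻⁴·Σ'_q p1RecTable a h χ²|·|⁻⁶ (par p) (q − p) s ≤ p1Paym p s`
— an INFINITE lattice column sum (the payment site `p` makes for bond `p → p+s` on behalf of every ledger `q`), certified outside the
kernel by `paycert.py` (HOME CERT §35: per-site interval bounds for `|y_q − y_p| ≤ 80a` + an analytic lattice tail).  Here the part
of the column over the sites OUTSIDE the `44a` site box of part 90 (`Icc(p.1 ± 53) × Icc(p.2.1 ± 69) × Icc(p.2.2 ± 51)`) is bounded in
the kernel, for ANY base `p` and ANY offset `s`, uniformly on the `HcpFamilyMin` box: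
  `(193/125)(2/5)a⁻⁴ · Σ'_{q ∉ box} p1RecTable … (q − p) s ≤ (3/200000) · p1BondW 1 p s`,
where `p1BondW (fun _ => 1) p s = 4·#{forward tetrahedron slots} + 16·#{forward octahedron cubes}` of the oriented bond `p → p+s`
(`40` on the FULL columns, `32` octs-only, `8` tets-only, `0` otherwise; CERT §35 (a)).  Chain: a far ledger `q` (`r = ‖y_q − y_p‖
≥ 44a`) reads the cells of the eight cubes cornering at `p`, every point of which is within `5a/2` of `y_p` (part 91), so each cell
weight is `≤ |T|·(r − 5a/2)⁻⁶ ≤ |T|(88/83)⁶r⁻⁶` (`χ² ≤ 1`, `|T| = √3a²h/12`; `p1SiteW_far_le`, `p1BondW_le_mul_count`,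
`p1RecTable_far_le`); the lattice sum `Σ_{r ≥ 44a} r⁻⁶ ≤ (2/(√3a²h))·4π·((39a)⁻³/3 + (5a/4)(39a)⁻⁴ + (5a²/4)(39a)⁻⁵)` is part 91
(`|T|` cancels against the cube volume `6|T|`); numerically `≤ 1.392e−5 · N` per unit count at `a ≥ 0.97119` (`π < 3.1416`),
rounded up to `3/200000`.  Consequence **`coreJointCoercive_cell_of_certificates₁₁`**: part 90's endpoint with (PAY) replaced by
(PAY_fin): the column sum over the FINITELY MANY sites of the box is `≤ p1Paym p s − (3/200000)·p1BondW 1 p s`.  Certificate side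
(HOME CERT §38): paycert's bound of the infinite column (binding FULL column A `(0,1,0)`: `0.206051177`) plus `40·3/200000 = 6.0e−4`
is `0.206651 ≤ p1Paym = 0.2075570` (margin `0.44 %`); paycert's analytic tail beyond `80a` leaves the trust base.
* `p1SlotW_const_mul`, `p1SlotW_le_of_le`, `p1BondW_le_mul_count`; `p1SiteW_far_le`, `p1RecTable_far_le`;
* **`payColumn_tail_le`** (the tail lemma, any base, any offset), `payColumn_le_of_fin` (finite column + tail ⇒ (PAY));
* **`coreJointCoercive_cell_of_certificates₁₁`** — ALL FIVE hypotheses ((B∃_fin), (S_fin), (TAB), (PAY_fin), (NC∃)) are now finite statements.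
NOT a proof of H12⋆ (the five finite hypotheses are verified outside the kernel), NOT summit progress.  [folklore]
-/

noncomputable section

open Set Function Metric MeasureTheory Filter Topology
open scoped BigOperators NNReal ENNReal Classical

namespace Summit.AtomisticToContinuum.Crystallization.Theorems.StrictSplittingRuleBirth

open Literature.MathematicalPhysics.StatisticalMechanics
open Summit.AtomisticToContinuum.Crystallization.Theorems.PalmUnimodularRigidity.LayeredLawsSelectHcp

/-! ## Slot-weight algebra: homogeneity and localised monotonicity -/

/-- Homogeneity of slot weights in the cube coefficients. -/
theorem p1SlotW_const_mul {ι : Type*} [Fintype ι] (τ η : Bool → ι → ℤ × ℤ × ℤ) (k : ℝ) (c : ℤ × ℤ × ℤ → ℝ) (q d : ℤ × ℤ × ℤ) :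
    p1SlotW τ η (fun n => k * c n) q d = k * p1SlotW τ η c q d := by
  unfold p1SlotW
  rw [Finset.mul_sum]
  refine Finset.sum_congr rfl fun o _ => ?_
  rw [Finset.mul_sum]
  refine Finset.sum_congr rfl fun i _ => ?_
  split_ifs <;> simp

/-- Localised monotonicity of slot weights: only the cubes `q − o`, `o ∈ {0,1}³`, are read. -/
theorem p1SlotW_le_of_le {ι : Type*} [Fintype ι] (τ η : Bool → ι → ℤ × ℤ × ℤ) {c c' : ℤ × ℤ × ℤ → ℝ} (q d : ℤ × ℤ × ℤ)
    (h : ∀ o ∈ p1Corners, c (q - o) ≤ c' (q - o)) : p1SlotW τ η c q d ≤ p1SlotW τ η c' q d := by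
  unfold p1SlotW
  refine Finset.sum_le_sum fun o ho => Finset.sum_le_sum fun i _ => ?_
  split_ifs
  · exact h o ho
  · exact le_rfl

/-- Constant cube coefficients scale out of a slot weight. -/
theorem p1SlotW_const_smul {ι : Type*} [Fintype ι] (τ η : Bool → ι → ℤ × ℤ × ℤ) (B k : ℝ) (q d : ℤ × ℤ × ℤ) :
    p1SlotW τ η (fun _ => B * k) q d = B * p1SlotW τ η (fun _ => k) q d :=
  p1SlotW_const_mul τ η B (fun _ => k) q d

/-- **Bond weight against the slot count**: if every cell weight of the cubes `q − o` (`o ∈ {0,1}³`) is at most `B`, then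
`p1BondW W q d ≤ B · p1BondW 1 q d`, where `p1BondW (fun _ => 1) q d = 4·#{forward tet slots} + 16·#{forward oct cubes}` of the
oriented bond `q → q + d` (the octahedron weight of a cube is the max of its four quarters). -/
theorem p1BondW_le_mul_count {W : (ℤ × ℤ × ℤ) × Fin 6 → ℝ} {B : ℝ} (q d : ℤ × ℤ × ℤ)
    (hWB : ∀ o ∈ p1Corners, ∀ π : Fin 6, W (q - o, π) ≤ B) :
    p1BondW W q d ≤ B * p1BondW (fun _ => (1 : ℝ)) q d := by
  have hO : ∀ o ∈ p1Corners, p1OctW W (q - o) ≤ B := fun o ho => by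
    unfold p1OctW
    exact max_le (max_le (hWB o ho 2) (hWB o ho 3)) (max_le (hWB o ho 4) (hWB o ho 5))
  have hO1 : ∀ n, p1OctW (fun _ => (1 : ℝ)) n = 1 := fun n => by simp [p1OctW]
  have e0 := p1SlotW_le_of_le (fun b => p1TetTail b 0) (fun b => p1TetHead b 0) (c := fun n => 4 * W (n, 0))
    (c' := fun _ => B * 4) q d (fun o ho => by linarith [hWB o ho 0])
  have e1 := p1SlotW_le_of_le (fun b => p1TetTail b 1) (fun b => p1TetHead b 1) (c := fun n => 4 * W (n, 1))
    (c' := fun _ => B * 4) q d (fun o ho => by linarith [hWB o ho 1])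
  have e2 := p1SlotW_le_of_le p1OctTail p1OctHead (c := fun n => 16 * p1OctW W n)
    (c' := fun _ => B * 16) q d (fun o ho => by linarith [hO o ho])
  rw [p1SlotW_const_smul] at e0 e1 e2
  calc p1BondW W q d
      ≤ B * p1SlotW (fun b => p1TetTail b 0) (fun b => p1TetHead b 0) (fun _ => 4) q d +
        B * p1SlotW (fun b => p1TetTail b 1) (fun b => p1TetHead b 1) (fun _ => 4) q d +
        B * p1SlotW p1OctTail p1OctHead (fun _ => 16) q d := add_le_add (add_le_add e0 e1) e2
    _ = B * p1BondW (fun _ => (1 : ℝ)) q d := by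
        simp only [p1BondW, hO1, mul_one]
        ring

/-! ## A far ledger's cell weights near the base -/

/-- **A far ledger's cell weight near the base**: for `‖y_q − y_p‖ = r ≥ 44a`, a corner `o` and any piece `π`, the split-weight cell weight
`W_q(p − o, π) = ∫_{cell} χ²(y − y_q)|y − y_q|⁻⁶ dy ≤ (√3a²h/12)·((r − 5a/2)²)⁻³` (every point of the cell is within `5a/2` of `y_p`
by part 91, and `χ² ≤ 1`). -/
theorem p1SiteW_far_le {a h : ℝ} (ha : 0 < a) (hh : 0 < h) (hhi : h ≤ 81657 / 100000 * a) (p q : ℤ × ℤ × ℤ)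
    (hfar : 44 * a ≤ ‖hcpSite a h q - hcpSite a h p‖) {o : ℤ × ℤ × ℤ} (ho : o ∈ p1Corners) (π : Fin 6) :
    p1SiteW a h (p1SplitDensity (81 / 20 * a) (27 / 5 * a)) q (p - o, π) ≤
      √3 * a ^ 2 * h / 12 * (((‖hcpSite a h q - hcpSite a h p‖ - 5 / 2 * a) ^ 2)⁻¹) ^ 3 := by
  set r := ‖hcpSite a h q - hcpSite a h p‖ with hr
  set T : (ℤ × ℤ × ℤ) × Fin 6 := (p - o, π) with hT
  have hρ : (0 : ℝ) ≤ 5 / 2 * a := by positivity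
  have hρr : 5 / 2 * a ≤ r := by linarith
  have hpos : 0 < (r - 5 / 2 * a) ^ 2 := by
    have : 0 < r - 5 / 2 * a := by linarith
    positivity
  set d : Fin 3 → ℝ := fun k => hcpSite a h p k - hcpSite a h q k with hd_def
  have hd : fpSq d = r ^ 2 := by
    rw [hr, ← norm_sub_rev, norm_sq_eq_three]
    simp [fpSq, hd_def]
  -- pointwise bound on the cell
  have hpt : ∀ y ∈ p1RealCell a h T, ‖p1SplitDensity (81 / 20 * a) (27 / 5 * a) (y - fun k => hcpSite a h q k)‖ ≤
      (((r - 5 / 2 * a) ^ 2)⁻¹) ^ 3 := by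
    intro y hy
    rw [Real.norm_eq_abs, abs_of_nonneg (p1SplitDensity_nonneg _ _ _)]
    set u : Fin 3 → ℝ := fun k => y k - hcpSite a h p k with hu_def
    have hu : fpSq u ≤ (5 / 2 * a) ^ 2 := by
      have h1 := fpSq_sub_corner_le_of_mem_cell (n := p - o) (π := π) ha.ne' hh.ne' ho hy
      simp only [sub_add_cancel] at h1
      exact h1.trans (cornerRad_sq_le hh.le hhi)
    have hx : (y - fun k => hcpSite a h q k) = d + u := by
      funext k
      simp only [hd_def, hu_def, Pi.sub_apply, Pi.add_apply]
      ring
    have hlo := sq_le_fpSq_add hρ hρr hd hu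
    unfold p1SplitDensity
    rw [hx]
    have hinv : (fpSq (d + u))⁻¹ ≤ ((r - 5 / 2 * a) ^ 2)⁻¹ := inv_anti₀ hpos hlo
    have h3 : (fpSq (d + u))⁻¹ ^ 3 ≤ (((r - 5 / 2 * a) ^ 2)⁻¹) ^ 3 :=
      pow_le_pow_left₀ (inv_nonneg.2 (fpSq_nonneg _)) hinv 3
    calc fpChi ((81 / 20 * a) ^ 2) ((27 / 5 * a) ^ 2) (d + u) ^ 2 * (fpSq (d + u))⁻¹ ^ 3
        ≤ 1 * (fpSq (d + u))⁻¹ ^ 3 :=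
          mul_le_mul_of_nonneg_right (fpChi_sq_le_one _ _ _) (pow_nonneg (inv_nonneg.2 (fpSq_nonneg _)) 3)
      _ ≤ (((r - 5 / 2 * a) ^ 2)⁻¹) ^ 3 := by rw [one_mul]; exact h3
  have hvol : volume (p1RealCell a h T) < ∞ := by
    rw [volume_p1RealCell ha hh]
    exact ENNReal.ofReal_lt_top
  have key := norm_setIntegral_le_of_norm_le_const hvol hpt
  rw [measureReal_def, volume_real_p1RealCell ha hh, Real.norm_eq_abs] at key
  have := le_abs_self (∫ y in p1RealCell a h T, p1SplitDensity (81 / 20 * a) (27 / 5 * a) (y - fun k => hcpSite a h q k))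
  unfold p1SiteW
  linarith

/-- **One far ledger's column entry against the slot count**: for `‖y_q − y_p‖ = r ≥ 44a`, any `p`, any offset `s`,
`p1RecTable … (par p) (q − p) s ≤ (√3a²h/12)·((r − 5a/2)²)⁻³ · p1BondW 1 p s` (the table entry IS `p1BondW (W_q) p s`, part 17). -/
theorem p1RecTable_far_le {a h : ℝ} (ha : 0 < a) (hh : 0 < h) (hhi : h ≤ 81657 / 100000 * a) (p q s : ℤ × ℤ × ℤ)
    (hfar : 44 * a ≤ ‖hcpSite a h q - hcpSite a h p‖) :
    p1RecTable a h (p1SplitDensity (81 / 20 * a) (27 / 5 * a)) (decide (Even p.1)) (q - p) s ≤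
      √3 * a ^ 2 * h / 12 * (((‖hcpSite a h q - hcpSite a h p‖ - 5 / 2 * a) ^ 2)⁻¹) ^ 3 * p1BondW (fun _ => (1 : ℝ)) p s := by
  rw [show decide (Even p.1) = p1Par p from rfl, ← p1BondW_p1SiteW_eq_p1RecTable ha.ne' hh.ne']
  exact p1BondW_le_mul_count p s fun o ho π => p1SiteW_far_le ha hh hhi p q hfar ho π

/-- The table entries are nonnegative (any `p, q, s`). -/
theorem p1RecTable_splitDensity_nonneg {a h : ℝ} (ha : 0 < a) (hh : 0 < h) (p q s : ℤ × ℤ × ℤ) :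
    0 ≤ p1RecTable a h (p1SplitDensity (81 / 20 * a) (27 / 5 * a)) (decide (Even p.1)) (q - p) s := by
  rw [show decide (Even p.1) = p1Par p from rfl, ← p1BondW_p1SiteW_eq_p1RecTable ha.ne' hh.ne']
  exact p1BondW_nonneg (fun i => p1SiteW_nonneg a h (p1SplitDensity_nonneg _ _) q i) p s

/-! ## The (PAY) tail lemma -/

/-- `(r − 5a/2)⁻⁶ ≤ (88/83)⁶·r⁻⁶` for `r ≥ 44a`. -/
theorem inv_pow_shift_le {a r : ℝ} (ha : 0 < a) (hr : 44 * a ≤ r) :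
    (((r - 5 / 2 * a) ^ 2)⁻¹) ^ 3 ≤ (88 / 83 : ℝ) ^ 6 * ((r ^ 2)⁻¹) ^ 3 := by
  have hr0 : 0 < r := by linarith
  have h1 : 83 / 88 * r ≤ r - 5 / 2 * a := by linarith
  have h2 : (83 / 88 * r) ^ 2 ≤ (r - 5 / 2 * a) ^ 2 := pow_le_pow_left₀ (by positivity) h1 2
  have h3 : ((r - 5 / 2 * a) ^ 2)⁻¹ ≤ ((83 / 88 * r) ^ 2)⁻¹ := inv_anti₀ (by positivity) h2
  have h4 : (((r - 5 / 2 * a) ^ 2)⁻¹) ^ 3 ≤ (((83 / 88 * r) ^ 2)⁻¹) ^ 3 :=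
    pow_le_pow_left₀ (inv_nonneg.2 (sq_nonneg _)) h3 3
  have h5 : (((83 / 88 * r) ^ 2)⁻¹) ^ 3 = (88 / 83 : ℝ) ^ 6 * ((r ^ 2)⁻¹) ^ 3 := by
    rw [mul_pow, mul_inv, mul_pow]
    norm_num
  rw [← h5]
  exact h4

/-- **THE (PAY) TAIL LEMMA (the column sum over the sites outside the `44a` box, in the kernel).**  For the hcp family minimiser
`(a,h)`, ANY base site `p` and ANY offset `s`: the family `q ↦ [q ∉ box]·p1RecTable … (par p) (q − p) s` is summable and
`(193/125)(2/5)a⁻⁴ · Σ'_{q ∉ Icc(p.1 ± 53) × Icc(p.2.1 ± 69) × Icc(p.2.2 ± 51)} p1RecTable … (q − p) s ≤ (3/200000)·p1BondW 1 p s`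
(`≈ 1.392e−5` per unit count at `a = 0.97119`; `40·3/200000 = 6.0e−4` on the FULL columns against the certificate's slack `1.5e−3`).
NOT a proof of H12⋆, NOT summit progress. [folklore] -/
theorem payColumn_tail_le {a h : ℝ} (ha : 0 < a) (hh : 0 < h) (hfam : HcpFamilyMin a h) (p s : ℤ × ℤ × ℤ) :
    Summable (fun q : ℤ × ℤ × ℤ =>
      if q ∈ Finset.Icc (p.1 - 53) (p.1 + 53) ×ˢ (Finset.Icc (p.2.1 - 69) (p.2.1 + 69) ×ˢ Finset.Icc (p.2.2 - 51) (p.2.2 + 51)) then (0 : ℝ)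
      else p1RecTable a h (p1SplitDensity (81 / 20 * a) (27 / 5 * a)) (decide (Even p.1)) (q - p) s) ∧
    (193 / 125) * (2 / 5) / a ^ 4 * (∑' q : ℤ × ℤ × ℤ,
      if q ∈ Finset.Icc (p.1 - 53) (p.1 + 53) ×ˢ (Finset.Icc (p.2.1 - 69) (p.2.1 + 69) ×ˢ Finset.Icc (p.2.2 - 51) (p.2.2 + 51)) then (0 : ℝ)
      else p1RecTable a h (p1SplitDensity (81 / 20 * a) (27 / 5 * a)) (decide (Even p.1)) (q - p) s) ≤
      3 / 200000 * p1BondW (fun _ => (1 : ℝ)) p s := by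
  obtain ⟨hlo, hhi⟩ := ratioBox_of_hcpFamilyMin ha hh hfam
  obtain ⟨hA, -⟩ := hcpFamilyMin_enclosure ha hh hfam
  have ha1 : (97119 / 100000 : ℝ) ≤ a := by
    rw [abs_sub_le_iff] at hA
    linarith [hA.2]
  set Box := Finset.Icc (p.1 - 53) (p.1 + 53) ×ˢ (Finset.Icc (p.2.1 - 69) (p.2.1 + 69) ×ˢ Finset.Icc (p.2.2 - 51) (p.2.2 + 51)) with hBox
  set N := p1BondW (fun _ => (1 : ℝ)) p s with hN
  have hN0 : 0 ≤ N := p1BondW_nonneg (fun _ => zero_le_one) p s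
  set I : ℝ := 4 * Real.pi * (((39 * a) ^ 3)⁻¹ / 3 + 5 / 4 * a * ((39 * a) ^ 4)⁻¹ + 5 / 4 * a ^ 2 * ((39 * a) ^ 5)⁻¹) with hIdef
  set φ : ℤ × ℤ × ℤ → ℝ := fun q =>
    if 44 * a ≤ ‖hcpSite a h q - hcpSite a h p‖ then ((‖hcpSite a h q - hcpSite a h p‖ ^ 2)⁻¹) ^ 3 else 0 with hφ
  obtain ⟨hφs, hφle⟩ := hcpSite_tsum_far44_inv_pow_six_le ha hh hhi p
  set G : ℤ × ℤ × ℤ → ℝ := fun q =>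
    if q ∈ Box then (0 : ℝ) else p1RecTable a h (p1SplitDensity (81 / 20 * a) (27 / 5 * a)) (decide (Even p.1)) (q - p) s with hG
  set C : ℝ := √3 * a ^ 2 * h / 12 * (88 / 83 : ℝ) ^ 6 * N with hC
  have hC0 : 0 ≤ C := by positivity
  have hG0 : ∀ q, 0 ≤ G q := fun q => by
    simp only [hG]
    split_ifs
    · exact le_rfl
    · exact p1RecTable_splitDensity_nonneg ha hh p q s
  have hGle : ∀ q, G q ≤ C * φ q := by
    intro q
    simp only [hG, hφ]
    by_cases hq : q ∈ Box
    · rw [if_pos hq]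
      exact mul_nonneg hC0 (by split_ifs <;> positivity)
    · have hfar : 44 * a ≤ ‖hcpSite a h q - hcpSite a h p‖ := fortyfour_le_of_not_mem_siteBox44 ha hlo p q hq
      rw [if_neg hq, if_pos hfar]
      have h1 := p1RecTable_far_le ha hh hhi p q s hfar
      have h2 := inv_pow_shift_le ha hfar
      have hT : 0 ≤ √3 * a ^ 2 * h / 12 := by positivity
      calc p1RecTable a h (p1SplitDensity (81 / 20 * a) (27 / 5 * a)) (decide (Even p.1)) (q - p) s
          ≤ √3 * a ^ 2 * h / 12 * (((‖hcpSite a h q - hcpSite a h p‖ - 5 / 2 * a) ^ 2)⁻¹) ^ 3 * N := h1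
        _ ≤ √3 * a ^ 2 * h / 12 * ((88 / 83 : ℝ) ^ 6 * ((‖hcpSite a h q - hcpSite a h p‖ ^ 2)⁻¹) ^ 3) * N :=
            mul_le_mul_of_nonneg_right (mul_le_mul_of_nonneg_left h2 hT) hN0
        _ = C * ((‖hcpSite a h q - hcpSite a h p‖ ^ 2)⁻¹) ^ 3 := by simp only [hC]; ring
  have hCφ : Summable fun q => C * φ q := hφs.mul_left C
  have hGs : Summable G := hCφ.of_nonneg_of_le hG0 hGle
  refine ⟨hGs, ?_⟩
  have hGt : ∑' q, G q ≤ C * (2 / (√3 * a ^ 2 * h) * I) := by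
    calc ∑' q, G q ≤ ∑' q, C * φ q := Summable.tsum_le_tsum hGle hGs hCφ
      _ = C * ∑' q, φ q := tsum_mul_left
      _ ≤ C * (2 / (√3 * a ^ 2 * h) * I) := mul_le_mul_of_nonneg_left hφle hC0
  have hκ : (0 : ℝ) ≤ (193 / 125) * (2 / 5) / a ^ 4 := by positivity
  refine (mul_le_mul_of_nonneg_left hGt hκ).trans ?_
  -- the numeric constant: everything cancels to `N·(c₀·π/a⁷)`
  have h3 : (√3 : ℝ) ≠ 0 := by positivity
  have ha0 : a ≠ 0 := ha.ne'
  have hh0 : h ≠ 0 := hh.ne'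
  set Q₀ : ℝ := (193 / 125) * (2 / 5) * (88 / 83 : ℝ) ^ 6 * (2 / 3) *
    (((39 : ℝ) ^ 3)⁻¹ / 3 + 5 / 4 * ((39 : ℝ) ^ 4)⁻¹ + 5 / 4 * ((39 : ℝ) ^ 5)⁻¹) with hQ₀
  have hQ : (193 / 125) * (2 / 5) / a ^ 4 * (C * (2 / (√3 * a ^ 2 * h) * I)) = N * (Real.pi * Q₀ / a ^ 7) := by
    simp only [hC, hIdef, hQ₀]
    field_simp
    ring
  rw [hQ]
  -- `π·Q₀/a⁷ ≤ 3/200000` on the box (`π < 3.1416`, `a ≥ 0.97119`)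
  have hQ0 : 0 < Q₀ := by rw [hQ₀]; positivity
  have ha7 : (97119 / 100000 : ℝ) ^ 7 ≤ a ^ 7 := pow_le_pow_left₀ (by norm_num) ha1 7
  have hnum : Real.pi * Q₀ / a ^ 7 ≤ 3 / 200000 := by
    rw [div_le_iff₀ (by positivity : (0 : ℝ) < a ^ 7)]
    calc Real.pi * Q₀ ≤ 3.1416 * Q₀ := mul_le_mul_of_nonneg_right Real.pi_lt_d4.le hQ0.le
      _ ≤ 3 / 200000 * (97119 / 100000 : ℝ) ^ 7 := by rw [hQ₀]; norm_num
      _ ≤ 3 / 200000 * a ^ 7 := mul_le_mul_of_nonneg_left ha7 (by norm_num)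
  calc N * (Real.pi * Q₀ / a ^ 7) ≤ N * (3 / 200000) := mul_le_mul_of_nonneg_left hnum hN0
    _ = 3 / 200000 * N := mul_comm _ _


/-! ## Finite column + kernel tail ⇒ (PAY); the endpoint with all five hypotheses finite -/

/-- **Finite column + kernel tail ⇒ (PAY).**  For ANY base `p` and ANY offset `s`: if the column sum over the sites of the `44a` box is
`≤ p1Paym p s − (3/200000)·p1BondW 1 p s`, then the INFINITE column sum of hypothesis (PAY) of part 90 is `≤ p1Paym p s`
(the column is summable and splits into the finite box part and the tail of `payColumn_tail_le`). -/
theorem payColumn_le_of_fin {a h : ℝ} (ha : 0 < a) (hh : 0 < h) (hfam : HcpFamilyMin a h) (p s : ℤ × ℤ × ℤ)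
    (hfin : (193 / 125) * (2 / 5) / a ^ 4 *
      (∑ q ∈ Finset.Icc (p.1 - 53) (p.1 + 53) ×ˢ (Finset.Icc (p.2.1 - 69) (p.2.1 + 69) ×ˢ Finset.Icc (p.2.2 - 51) (p.2.2 + 51)),
        p1RecTable a h (p1SplitDensity (81 / 20 * a) (27 / 5 * a)) (decide (Even p.1)) (q - p) s) ≤
      p1Paym p s - 3 / 200000 * p1BondW (fun _ => (1 : ℝ)) p s) :
    (193 / 125) * (2 / 5) / a ^ 4 *
      (∑' q : ℤ × ℤ × ℤ, p1RecTable a h (p1SplitDensity (81 / 20 * a) (27 / 5 * a)) (decide (Even p.1)) (q - p) s) ≤ p1Paym p s := by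
  obtain ⟨hGs, hGt⟩ := payColumn_tail_le ha hh hfam p s
  set Box := Finset.Icc (p.1 - 53) (p.1 + 53) ×ˢ (Finset.Icc (p.2.1 - 69) (p.2.1 + 69) ×ˢ Finset.Icc (p.2.2 - 51) (p.2.2 + 51)) with hBox
  set f : ℤ × ℤ × ℤ → ℝ := fun q => p1RecTable a h (p1SplitDensity (81 / 20 * a) (27 / 5 * a)) (decide (Even p.1)) (q - p) s with hf
  have hsplit : ∀ q, f q = (if q ∈ Box then f q else 0) + (if q ∈ Box then (0 : ℝ) else f q) := fun q => by
    split_ifs <;> simp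
  have hfin_s : Summable fun q => if q ∈ Box then f q else 0 :=
    summable_of_ne_finset_zero (s := Box) fun q hq => if_neg hq
  have htsum_fin : ∑' q, (if q ∈ Box then f q else 0) = ∑ q ∈ Box, f q := by
    rw [tsum_eq_sum (s := Box) fun q hq => if_neg hq]
    exact Finset.sum_congr rfl fun q hq => if_pos hq
  have htot : ∑' q, f q = ∑ q ∈ Box, f q + ∑' q, (if q ∈ Box then (0 : ℝ) else f q) := by
    rw [← htsum_fin, ← hfin_s.tsum_add hGs]
    exact tsum_congr hsplit
  rw [htot, mul_add]
  linarith

/-- **H12⋆ ON THE BOX FROM FIVE CLOSED CERTIFICATE STATEMENTS — ALL FIVE FINITE.**  Part 90's `coreJointCoercive_cell_of_certificates₁₀`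
with hypothesis (PAY) (27 × 2 INFINITE lattice column sums) replaced by (PAY_fin): per representative `p` and offset `s ∈ p1BondOffsets`,
the column sum over the FINITELY MANY sites of the `44a` site box `Icc(p.1 ± 53) × Icc(p.2.1 ± 69) × Icc(p.2.2 ± 51)` is at most
`p1Paym p s − (3/200000)·p1BondW 1 p s` (`p1BondW (fun _ => 1) p s` = `4·#tet slots + 16·#oct cubes` oriented `p → p+s`: `40` / `32` /
`8` / `0`); the sum over every other site is the kernel theorem `payColumn_tail_le`.  The other four hypotheses are verbatim, so
(B∃_fin), (S_fin), (TAB), (PAY_fin), (NC∃) are now ALL statements about finitely many explicit objects.  NOT a proof of H12⋆ (the five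
finite hypotheses are verified outside the kernel: HOME CERT §31/§29/§34/§35+§38/§34), NOT summit progress. -/
theorem coreJointCoercive_cell_of_certificates₁₁ {a h : ℝ} (ha : 0 < a) (hh : 0 < h) (hfam : HcpFamilyMin a h)
    -- (B∃_fin) THE PER-CELL BUDGET at each representative FOR SOME allocation tables that follow the EXACT RULE on the cells ≥ 44a away, asked only for the FINITELY MANY cells of the 44a cell box with a vertex within 44a
    (hB : ∀ p ∈ ({(0, 0, 0), (1, 0, 0)} : Finset (ℤ × ℤ × ℤ)),
      ∃ θ θv : (ℤ × ℤ × ℤ) × (ℤ × ℤ × ℤ) → (ℤ × ℤ × ℤ) × Fin 6 → ℝ,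
        (∀ e T, 0 ≤ θ e T) ∧ (∀ e, (Function.support (θ e)).Finite) ∧ (∀ T, (Function.support fun e => θ e T).Finite) ∧
        (∀ e, p1FarW a h (p1Phi0 p) p e ≠ 0 → ∑ᶠ T, θ e T = 1) ∧
        (∀ e T, θ e T ≠ 0 → ∃ m m' : Fin 4, e.1 = T.1 + p1VertOff (p1Par T.1) T.2 m ∧
          e.1 + e.2 = T.1 + p1VertOff (p1Par T.1) T.2 m') ∧
        (∀ e T, 0 ≤ θv e T) ∧ (∀ e, (Function.support (θv e)).Finite) ∧ (∀ T, (Function.support fun e => θv e T).Finite) ∧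
        (∀ e, (∑ i : Fin 3, (2 / 3) * ((if e.2 = p1RouteOff e.1 i then p1FarWv a h (p1Phi0 p) p e.1 else 0) +
          (if p1RouteOff (e.1 - (p1SV - e.2)) i = p1SV - e.2 then p1FarWv a h (p1Phi0 p) p (e.1 - (p1SV - e.2)) else 0))) ≠ 0 → ∑ᶠ T, θv e T = 1) ∧
        (∀ e T, θv e T ≠ 0 → ∃ m m' : Fin 4, e.1 = T.1 + p1VertOff (p1Par T.1) T.2 m ∧
          e.1 + e.2 = T.1 + p1VertOff (p1Par T.1) T.2 m') ∧
        (∀ T : (ℤ × ℤ × ℤ) × Fin 6, (∀ m : Fin 4, 44 * a ≤ ‖hcpSite a h (T.1 + p1VertOff (p1Par T.1) T.2 m) - hcpSite a h p‖) →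
          ∀ e, θ e T = p1ThetaX a h p e T ∧ θv e T = p1ThetaX a h p e T) ∧
        ∀ (T : (ℤ × ℤ × ℤ) × Fin 6), T.1 ∈ p1CellBox44 p →
          (∃ m : Fin 4, ‖hcpSite a h (T.1 + p1VertOff (p1Par T.1) T.2 m) - hcpSite a h p‖ < 44 * a) → ∀ (G : Fin 3 → Fin 3 → ℝ),
      (∑ᶠ e : (ℤ × ℤ × ℤ) × (ℤ × ℤ × ℤ), θ e T * p1FarW a h (p1Phi0 p) p e *
          fpSq (fun k => (hcpSite a h (e.1 + e.2) 0 - hcpSite a h e.1 0) * G 0 k +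
            (hcpSite a h (e.1 + e.2) 1 - hcpSite a h e.1 1) * G 1 k + (hcpSite a h (e.1 + e.2) 2 - hcpSite a h e.1 2) * G 2 k)) +
      (∑ᶠ e : (ℤ × ℤ × ℤ) × (ℤ × ℤ × ℤ), θv e T *
          (∑ i : Fin 3, (2 / 3) * ((if e.2 = p1RouteOff e.1 i then p1FarWv a h (p1Phi0 p) p e.1 else 0) +
            (if p1RouteOff (e.1 - (p1SV - e.2)) i = p1SV - e.2 then p1FarWv a h (p1Phi0 p) p (e.1 - (p1SV - e.2)) else 0))) *
          fpSq (fun k => (hcpSite a h (e.1 + e.2) 0 - hcpSite a h e.1 0) * G 0 k +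
            (hcpSite a h (e.1 + e.2) 1 - hcpSite a h e.1 1) * G 1 k + (hcpSite a h (e.1 + e.2) 2 - hcpSite a h e.1 2) * G 2 k)) +
      p1CellDefectG a h (fun y k l => (193 / 125) * ((7 * (5 / 4 : ℝ) + 3 / 4) / 4) * fpChi ((81 / 20 * a) ^ 2) ((27 / 5 * a) ^ 2) (y - fun k => hcpSite a h p k) ^ 2 *
          (fpSq (y - fun k => hcpSite a h p k))⁻¹ ^ 5 * ((y - fun k => hcpSite a h p k) k * (y - fun k => hcpSite a h p k) l)) T G ≤
      (193 / 125) * ((5 / 2 * (1 / 24 * fpSymSq G) + 5 / 2 * (1 / 24 * (fpFrob G - fpSymSq G))) *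
        ∫ y in p1RealCell a h T, fpChi ((81 / 20 * a) ^ 2) ((27 / 5 * a) ^ 2) (y - fun k => hcpSite a h p k) ^ 2 * (fpSq (y - fun k => hcpSite a h p k))⁻¹ ^ 3))
    -- (S) per-site domination off the PINNED reach set at the FINITELY MANY sites of the 20a index box with `‖y_q − y_p‖ < 20a`; (TAB) the PINNED certified tables
    (hS : ∀ p ∈ ({(0, 0, 0), (1, 0, 0)} : Finset (ℤ × ℤ × ℤ)),
      ∀ q ∈ Finset.Icc (p.1 - 26) (p.1 + 26) ×ˢ (Finset.Icc (p.2.1 - 34) (p.2.1 + 34) ×ˢ Finset.Icc (p.2.2 - 23) (p.2.2 + 23)),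
      q ∉ p1QB p → q ≠ p → ‖hcpSite a h q - hcpSite a h p‖ < 20 * a → ∀ z : Fin 3 → ℝ,
      0 ≤ 1 / 2 * (ljSqDeriv (‖hcpSite a h q - hcpSite a h p‖ ^ 2) * fpSq z +
          2 * (1 / 2 * (7 * ((‖hcpSite a h q - hcpSite a h p‖ ^ 2)⁻¹) ^ 8 -
            4 * ((‖hcpSite a h q - hcpSite a h p‖ ^ 2)⁻¹) ^ 5)) * p1NRad a h p (fun _ => z) q ^ 2) +
        p1SiteBare a h (fun y k l => (193 / 125) * ((7 * (5 / 4 : ℝ) + 3 / 4) / 4) * fpChi ((81 / 20 * a) ^ 2) ((27 / 5 * a) ^ 2) (y - fun k => hcpSite a h p k) ^ 2 *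
          (fpSq (y - fun k => hcpSite a h p k))⁻¹ ^ 5 * ((y - fun k => hcpSite a h p k) k * (y - fun k => hcpSite a h p k) l)) (fun _ => z) q -
        p1SiteBare a h (fun y k l => (193 / 125) * ((3 / 4 : ℝ) / 4) * fpChi ((81 / 20 * a) ^ 2) ((27 / 5 * a) ^ 2) (y - fun k => hcpSite a h p k) ^ 2 *
          (fpSq (y - fun k => hcpSite a h p k))⁻¹ ^ 4 * (if k = l then 1 else 0)) (fun _ => z) q)
    (hTab : ∀ p ∈ ({(0, 0, 0), (1, 0, 0)} : Finset (ℤ × ℤ × ℤ)), ∀ q ∈ p1QB p, q ≠ p → ∀ z : Fin 3 → ℝ,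
      (p1LU p q).1 * p1NRad a h p (fun _ => z) q ^ 2 ≤
        p1SiteBare a h (fun y k l => (193 / 125) * ((7 * (5 / 4 : ℝ) + 3 / 4) / 4) * fpChi ((81 / 20 * a) ^ 2) ((27 / 5 * a) ^ 2) (y - fun k => hcpSite a h p k) ^ 2 *
          (fpSq (y - fun k => hcpSite a h p k))⁻¹ ^ 5 * ((y - fun k => hcpSite a h p k) k * (y - fun k => hcpSite a h p k) l)) (fun _ => z) q ∧
      p1SiteBare a h (fun y k l => (193 / 125) * ((3 / 4 : ℝ) / 4) * fpChi ((81 / 20 * a) ^ 2) ((27 / 5 * a) ^ 2) (y - fun k => hcpSite a h p k) ^ 2 *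
          (fpSq (y - fun k => hcpSite a h p k))⁻¹ ^ 4 * (if k = l then 1 else 0)) (fun _ => z) q ≤ (p1LU p q).2 * fpSq z)
    -- (PAY_fin) the far table's column sums over the FINITELY MANY sites of the 44a site box, by the PINNED payments minus the kernel's tail allowance
    (hPAY : ∀ p ∈ ({(0, 0, 0), (1, 0, 0)} : Finset (ℤ × ℤ × ℤ)), ∀ s ∈ p1BondOffsets, (193 / 125) * (2 / 5) / a ^ 4 *
      (∑ q ∈ Finset.Icc (p.1 - 53) (p.1 + 53) ×ˢ (Finset.Icc (p.2.1 - 69) (p.2.1 + 69) ×ˢ Finset.Icc (p.2.2 - 51) (p.2.2 + 51)),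
        p1RecTable a h (p1SplitDensity (81 / 20 * a) (27 / 5 * a)) (decide (Even p.1)) (q - p) s) ≤
      p1Paym p s - 3 / 200000 * p1BondW (fun _ => (1 : ℝ)) p s)
    -- (NC∃) THE NEAR CERTIFICATE WITH THE EXACT COLLAR FLUX at both representatives, FOR SOME stencilled decaying finitely supported near tables
    (hNC : ∃ M₁ N : Bool → (ℤ × ℤ × ℤ) → (ℤ × ℤ × ℤ) → (ℤ × ℤ × ℤ) → ℝ, ∃ QT : (ℤ × ℤ × ℤ) → Finset (ℤ × ℤ × ℤ),
      (∀ b d s s', s ∉ p1BondOffsets ∨ s' ∉ p1BondOffsets → M₁ b d s s' = 0 ∧ N b d s s' = 0) ∧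
      (∃ C₁ : ℝ, ∀ p q : ℤ × ℤ × ℤ, ∀ s s', |M₁ (decide (Even p.1)) (q - p) s s'| ≤
        C₁ * ((1 + ‖hcpSite a h q - hcpSite a h p‖)⁻¹) ^ 6 ∧
      |N (decide (Even p.1)) (q - p) s s'| ≤ C₁ * ((1 + ‖hcpSite a h q - hcpSite a h p‖)⁻¹) ^ 6) ∧
      (∀ p ∈ ({(0, 0, 0), (1, 0, 0)} : Finset (ℤ × ℤ × ℤ)), ∀ q : ℤ × ℤ × ℤ, q ∉ QT p → ∀ s s',
      M₁ (decide (Even p.1)) (q - p) s s' = 0 ∧ M₁ (decide (Even q.1)) (p - q) s s' = 0 ∧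
      N (decide (Even p.1)) (q - p) s s' = 0 ∧ N (decide (Even q.1)) (p - q) s' s = 0) ∧
      ∀ p ∈ ({(0, 0, 0), (1, 0, 0)} : Finset (ℤ × ℤ × ℤ)), ∀ V : ℤ × ℤ × ℤ → (Fin 3 → ℝ), V p = 0 →
      (∀ Z : Fin 3 → Fin 3 → ℝ, (∀ j k, Z j k = -Z k j) →
        ∑ q ∈ (if Even p.1 then hcpStarIdx.image (fun d => d + p) else hcpStarIdx.image (fun d => p - d)), ∑ k : Fin 3, V q k * (∑ j : Fin 3, (hcpSite a h q j - hcpSite a h p j) * Z j k) = 0) →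
      0 ≤ p1NearForm a h (1 / 3) (1 / 12) (193 / 125) p p1Stencil (p1Beta a h) M₁ N (p1FarW a h (p1Phi0 p) p) p1SV (p1FarWv a h (p1Phi0 p) p) (fun s => -p1Beta a h (decide (Even p.1)) 0 s) (if Even p.1 then hcpStarIdx.image (fun d => d + p) else hcpStarIdx.image (fun d => p - d)) (p1QB p) (QT p) ∅ (p1FarLegs (p1Phi0 p) p) (fun q => (p1LU p q).1) (fun q => (p1LU p q).2) (p1Paym p) (fun _ => 0) (fun _ _ => 0) V -
        193 / 125 * p1ExactFluxSum a h p V) :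
    CoreJointCoercive a h (1 / 3) (1 / 12) :=
  coreJointCoercive_cell_of_certificates₁₀ ha hh hfam hB hS hTab
    (fun p hp s hs => payColumn_le_of_fin ha hh hfam p s (hPAY p hp s hs)) hNC

end Summit.AtomisticToContinuum.Crystallization.Theorems.StrictSplittingRuleBirth

end
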